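import Literature.NumberTheory.EllipticCurves.SelmerGaloisAction
import Literature.NumberTheory.EllipticCurves.SelmerProofs
import Literature.NumberTheory.EllipticCurves.PeriodIndexCorestrictionLocal
import Literature.NumberTheory.GaloisRepresentations.ContinuousH1
import Summits.BirchSwinnertonDyer.BirchSwinnertonDyer.Theorems.CMKolyvaginAtInertTwoInertOrderSplitting
import HarnessLib

/-!
# Route `CMKolyvaginAtInertTwo`, crux `CMKolyvaginExactAtInertTwo` (stmt-BirchSwinnertonDyer-24277):
# the inert-order splitting ON COHOMOLOGY — an equivariant endomorphism `η` of `E[n]` with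
# `η² + mη = c` and an automorphism `σ` of `K/k` whose lifts conjugate `η` to `η̄ = −η − m` make
# `H¹(K, E[n])` a `ℤ/n[η]⟨σ⟩`-module; hence (for `m, c` odd, `n = 2^M`) every `σ_*`- and `η_*`-stable
# finite subgroup `S` (a Selmer group, say) satisfies `S^{σ=1} = (1+σ)S`, `S = x₀S⁺ ⊕ S⁻`, `#S = (#S⁺)²`

Seat `bsd-line-cmk2-p1` g10 (cell `bsd-print-cf2`); helper (`--supports stmt-BirchSwinnertonDyer-24277`).
THEOREMS ONLY: no definition, no named fact, no `sorry`; no item is closed; BSD is not proved by this.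
Memo: `Cruxes/CMExactDescentAtTwo/MEMO-inert-order-splitting.md` §3–4 (this file is step 4.1–4.2 minus
the `H₂`-specific existence of `η`, which is ty2's `CartanAtTwo.*` transported to `K̄`).

* §1 (any topological group `G`, discrete `G`-module `M`): the maps `ψ_* = resH1Hom id ψ` on
  `H¹_cont(G, M)` induced by equivariant endomorphisms `ψ` inherit POLYNOMIAL RELATIONS
  (`resH1Hom_id_rel`: `ψ² + mψ = c ⟹ ψ_*² + mψ_* = c`) and ANTI-COMMUTATION with the map of any
  compatible pair `(φ, t)` (`resH1Hom_anti`: `ψ t = −tψ − m t ⟹ ψ_* T = −Tψ_* − m T`, `T = res_{(φ,t)}`)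
  — computed on continuous cocycles (`resH1Hom_oneCocycleClass`).
* §2 (`E = W/k`, `K/k`, `σ ∈ Aut(K/k)` with `σ² = 1`, a lift `τ̃` of `σ` to `K̄`, `η : E[n] → E[n]`
  `Γ_K`-equivariant with `η² + mη = c` on `E[n]` and `η(τ̃P) = −τ̃(ηP) − m·τ̃P`): the tree's
  `conjAct W σ n` and `η_*` satisfy the three hypotheses of `InertOrderSplitting` on `V = H¹(K, E[n])`
  (`conjAct_anti`, `eta_rel_H1`, `conjAct_invol`), whence `fixed_iff_exists_add_conjAct`
  (**`H¹(K,E[n])^{σ} = (1+σ_*)H¹(K,E[n])`**), `antifixed_iff_exists_sub_conjAct`, `exists_decomp_H1`, and for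
  `n = 2^M`, `c` odd and a finite stable subgroup `S`: **`natCard_stable_eq_sq` (`#S = (#S^{σ})²`)**.

On `H₂` (`η` = the CM generator of ty2's `CartanAtTwo`, `2` inert in `ℤ[η]`; `K ⊇ F` any number field on
which `σ` induces the non-trivial automorphism of `F`, e.g. `K = K_Heegner·F` with `σ|_{K_Heegner} = 1`)
this gives `#Sel_{2^M}(E/KF) = (#Sel_{2^M}(E/KF)^{σ})²` and the exact `τ`-splitting of the memo's §3.
References: Serre, *Galois Cohomology*, I.§2.4, VII.§5 Prop. 3 [SerreGaloisCohomology1997]; Lang,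
*Elliptic Functions*, Ch. 10 §4 [Lang1987]; folklore.
-/

-- single-conjunct summit: `Summit.BirchSwinnertonDyer.BirchSwinnertonDyer.…` repeats the name by design
set_option linter.dupNamespace false
set_option autoImplicit false

noncomputable section

open scoped Classical

namespace Summit.BirchSwinnertonDyer.BirchSwinnertonDyer.Theorems.InertOrderSplittingH1

open Literature.NumberTheory.EllipticCurves Literature.NumberTheory.GaloisRepresentations WeierstrassCurve
open Summit.BirchSwinnertonDyer.BirchSwinnertonDyer.Theorems.InertOrderSplitting

universe u v

/-! ## §1 Equivariant endomorphisms act on `H¹_cont(G, M)` compatibly with relations -/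

section Generic

variable {G : Type u} [Group G] [TopologicalSpace G] [IsTopologicalGroup G]
variable {M : Type u} [AddCommGroup M] [DistribMulAction G M] [TopologicalSpace M] [DiscreteTopology M]

/-- `[m • a] = m • [a]` for continuous `1`-cocycle classes (the class map is additive). [folklore] -/
theorem oneCocycleClass_zsmul' (m : ℤ) (a : contOneCocycles (discreteTopRep G M)) :
    oneCocycleClass (discreteTopRep G M) (m • a) = m • oneCocycleClass (discreteTopRep G M) a :=
  map_zsmul (oneCocycleClassₗ (discreteTopRep G M)).toAddMonoidHom m a

/-- `[-a] = -[a]` for continuous `1`-cocycle classes. [folklore] -/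
theorem oneCocycleClass_neg' (a : contOneCocycles (discreteTopRep G M)) :
    oneCocycleClass (discreteTopRep G M) (-a) = -oneCocycleClass (discreteTopRep G M) a :=
  map_neg (oneCocycleClassₗ (discreteTopRep G M)).toAddMonoidHom a

/-- **Polynomial relations pass to `H¹`**: if `ψ(ψv) + m·ψv = c·v` on `M` for an equivariant `ψ`, then
`ψ_*(ψ_*x) + m·ψ_*x = c·x` on `H¹_cont(G, M)` (`ψ_* = resH1Hom id ψ`; on cocycles `[a] ↦ [ψ ∘ a]`).
[cite: SerreGaloisCohomology1997, I.§2.4] -/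
theorem resH1Hom_id_rel (ψ : M →+ M)
    (hψ : ∀ (x : G) (v : M), ψ (ContinuousMonoidHom.id G x • v) = x • ψ v) (m c : ℤ)
    (hrel : ∀ v : M, ψ (ψ v) + m • ψ v = c • v) (x : discreteH1 G M) :
    resH1Hom (ContinuousMonoidHom.id G) ψ hψ (resH1Hom (ContinuousMonoidHom.id G) ψ hψ x) +
      m • resH1Hom (ContinuousMonoidHom.id G) ψ hψ x = c • x := by
  obtain ⟨a, rfl⟩ := oneCocycleClass_surjective (discreteTopRep G M) x
  rw [resH1Hom_oneCocycleClass, resH1Hom_oneCocycleClass, ← oneCocycleClass_zsmul',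
    ← oneCocycleClass_zsmul', ← oneCocycleClass_add]
  congr 1
  apply Subtype.ext
  ext g
  change ψ (ψ (a.1 g)) + (m • (contOneCocycles.pullback (ContinuousMonoidHom.id G)
      (resHomOfEquivariant (ContinuousMonoidHom.id G) ψ hψ) a)).1 g = (c • a).1 g
  change ψ (ψ (a.1 g)) + m • ψ (a.1 g) = c • a.1 g
  exact hrel _

variable {H : Type u} [Group H] [TopologicalSpace H] [IsTopologicalGroup H]

/-- **Anti-commutation passes to `H¹`**: for an equivariant `ψ : M → M` and a compatible pair
`(φ : G → G, t : M → M)` (e.g. conjugation by a lift of an outer automorphism) with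
`ψ(t v) = −t(ψ v) − m·t v`, the induced maps satisfy `ψ_*(T x) = −T(ψ_* x) − m·T x`
(`T = resH1Hom φ t`). [cite: SerreGaloisCohomology1997, I.§2.4] -/
theorem resH1Hom_anti (ψ : M →+ M)
    (hψ : ∀ (x : G) (v : M), ψ (ContinuousMonoidHom.id G x • v) = x • ψ v)
    (φ : G →ₜ* G) (t : M →+ M) (ht : ∀ (x : G) (v : M), t (φ x • v) = x • t v) (m : ℤ)
    (hanti : ∀ v : M, ψ (t v) = -t (ψ v) - m • t v) (x : discreteH1 G M) :
    resH1Hom (ContinuousMonoidHom.id G) ψ hψ (resH1Hom φ t ht x) =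
      -resH1Hom φ t ht (resH1Hom (ContinuousMonoidHom.id G) ψ hψ x) - m • resH1Hom φ t ht x := by
  obtain ⟨a, rfl⟩ := oneCocycleClass_surjective (discreteTopRep G M) x
  rw [resH1Hom_oneCocycleClass, resH1Hom_oneCocycleClass, resH1Hom_oneCocycleClass,
    resH1Hom_oneCocycleClass, ← oneCocycleClass_zsmul', ← oneCocycleClass_neg', ← oneCocycleClass_sub]
  congr 1
  apply Subtype.ext
  ext g
  change ψ (t (a.1 (φ g))) = -t (ψ (a.1 (φ g))) - m • t (a.1 (φ g))
  exact hanti _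

end Generic

/-! ## §2 `H¹(K, E[n])` with `σ_* = conjAct` and `η_*` -/

section Curve

variable {k : Type v} {K : Type u} [Field k] [Field K] [Algebra k K]
variable (W : WeierstrassCurve k) {σ : K ≃ₐ[k] K} {τ : AlgebraicClosure K ≃+* AlgebraicClosure K}
variable (n : ℤ)

/-- `conjAct W σ n` is the map of the compatible pair `(conjGalCMH, torsionMap)` of ANY lift `τ̃` of `σ`
(definitional for the chosen lift; `IsLiftOfAut.conjH1_eq_conjAct` for the others). [folklore] -/
theorem conjAct_eq_resH1Hom (hτ : IsLiftOfAut σ τ) :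
    conjAct W σ n = resH1Hom hτ.conjGalCMH (hτ.torsionMap W n) (hτ.torsionMap_smul W n) := by
  rw [← hτ.conjH1_eq_conjAct W n]
  rfl

/-- **`η_* σ_* = −σ_* η_* − m σ_*` on `H¹(K, E[n])`** from `η(τ̃P) = −τ̃(ηP) − m·τ̃P` on `E[n]`
(the second case of ty2's `CartanAtTwo.dichotomy`). [cite: Lang1987, Ch. 10 §4 Remark] -/
theorem conjAct_anti (η : geomTorsion (W.baseChange K) n →+ geomTorsion (W.baseChange K) n)
    (hη : ∀ (x : Field.absoluteGaloisGroup K) (P : geomTorsion (W.baseChange K) n),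
      η (ContinuousMonoidHom.id (Field.absoluteGaloisGroup K) x • P) = x • η P)
    (hτ : IsLiftOfAut σ τ) (m : ℤ)
    (hanti : ∀ P : geomTorsion (W.baseChange K) n,
      η (hτ.torsionMap W n P) = -hτ.torsionMap W n (η P) - m • hτ.torsionMap W n P)
    (x : galH1Torsion (W.baseChange K) n) :
    resH1Hom (ContinuousMonoidHom.id _) η hη (conjAct W σ n x) =
      -conjAct W σ n (resH1Hom (ContinuousMonoidHom.id _) η hη x) - m • conjAct W σ n x := by
  rw [conjAct_eq_resH1Hom W n hτ]
  exact resH1Hom_anti η hη hτ.conjGalCMH (hτ.torsionMap W n) (hτ.torsionMap_smul W n) m hanti x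

/-- **`η_*² + mη_* = c` on `H¹(K, E[n])`** from the same relation on `E[n]`. [folklore] -/
theorem eta_rel_H1 (η : geomTorsion (W.baseChange K) n →+ geomTorsion (W.baseChange K) n)
    (hη : ∀ (x : Field.absoluteGaloisGroup K) (P : geomTorsion (W.baseChange K) n),
      η (ContinuousMonoidHom.id (Field.absoluteGaloisGroup K) x • P) = x • η P)
    (m c : ℤ) (hrel : ∀ P : geomTorsion (W.baseChange K) n, η (η P) + m • η P = c • P)
    (x : galH1Torsion (W.baseChange K) n) :
    resH1Hom (ContinuousMonoidHom.id _) η hη (resH1Hom (ContinuousMonoidHom.id _) η hη x) +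
      m • resH1Hom (ContinuousMonoidHom.id _) η hη x = c • x :=
  resH1Hom_id_rel η hη m c hrel x

/-- `σ_*² = 1` on `H¹(K, E[n])` for an involution `σ` (tree `conjAct_conjAct_of_mul_self`). [folklore] -/
theorem conjAct_invol (hσ : σ * σ = 1) (x : galH1Torsion (W.baseChange K) n) :
    conjAct W σ n (conjAct W σ n x) = x :=
  conjAct_conjAct_of_mul_self W hσ n x

/-- **`H¹(K, E[n])^{σ} = (1 + σ_*) H¹(K, E[n])`** (`Ĥ⁰(⟨σ⟩, H¹(K,E[n])) = 0`): a `σ_*`-fixed class is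
`y + σ_* y` — for `m = 2k₀+1` odd, from `InertOrderSplitting.fixed_iff_exists_add_tau`.
[cite: Lang1987, Ch. 10 §4 Remark] -/
theorem fixed_iff_exists_add_conjAct (η : geomTorsion (W.baseChange K) n →+ geomTorsion (W.baseChange K) n)
    (hη : ∀ (x : Field.absoluteGaloisGroup K) (P : geomTorsion (W.baseChange K) n),
      η (ContinuousMonoidHom.id (Field.absoluteGaloisGroup K) x • P) = x • η P)
    (hσ : σ * σ = 1) (hτ : IsLiftOfAut σ τ) (k₀ : ℤ)
    (hanti : ∀ P : geomTorsion (W.baseChange K) n,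
      η (hτ.torsionMap W n P) = -hτ.torsionMap W n (η P) - (2 * k₀ + 1) • hτ.torsionMap W n P)
    (x : galH1Torsion (W.baseChange K) n) :
    conjAct W σ n x = x ↔ ∃ y, x = y + conjAct W σ n y :=
  fixed_iff_exists_add_tau (resH1Hom (ContinuousMonoidHom.id _) η hη) (conjAct W σ n) k₀
    (conjAct_invol W n hσ) (conjAct_anti W n η hη hτ (2 * k₀ + 1) hanti) x

/-- **`H¹(K, E[n])^{σ=−1} = (1 − σ_*) H¹(K, E[n])`** (`H¹(⟨σ⟩, H¹(K,E[n])) = 0`).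
[cite: Lang1987, Ch. 10 §4 Remark] -/
theorem antifixed_iff_exists_sub_conjAct (η : geomTorsion (W.baseChange K) n →+ geomTorsion (W.baseChange K) n)
    (hη : ∀ (x : Field.absoluteGaloisGroup K) (P : geomTorsion (W.baseChange K) n),
      η (ContinuousMonoidHom.id (Field.absoluteGaloisGroup K) x • P) = x • η P)
    (hσ : σ * σ = 1) (hτ : IsLiftOfAut σ τ) (k₀ : ℤ)
    (hanti : ∀ P : geomTorsion (W.baseChange K) n,
      η (hτ.torsionMap W n P) = -hτ.torsionMap W n (η P) - (2 * k₀ + 1) • hτ.torsionMap W n P)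
    (x : galH1Torsion (W.baseChange K) n) :
    conjAct W σ n x = -x ↔ ∃ y, x = y - conjAct W σ n y :=
  antifixed_iff_exists_sub_tau (resH1Hom (ContinuousMonoidHom.id _) η hη) (conjAct W σ n) k₀
    (conjAct_invol W n hσ) (conjAct_anti W n η hη hτ (2 * k₀ + 1) hanti) x

/-- **`H¹(K, E[n]) = x₀·H¹⁺ ⊕ H¹⁻`**: every class is `((k₀+1)s + η_* s) + r` with `σ_* s = s`,
`σ_* r = −r` (existence; uniqueness is `InertOrderSplitting.decomp_unique`). [cite: Lang1987, Ch. 10 §4 Remark] -/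
theorem exists_decomp_H1 (η : geomTorsion (W.baseChange K) n →+ geomTorsion (W.baseChange K) n)
    (hη : ∀ (x : Field.absoluteGaloisGroup K) (P : geomTorsion (W.baseChange K) n),
      η (ContinuousMonoidHom.id (Field.absoluteGaloisGroup K) x • P) = x • η P)
    (hσ : σ * σ = 1) (hτ : IsLiftOfAut σ τ) (k₀ : ℤ)
    (hanti : ∀ P : geomTorsion (W.baseChange K) n,
      η (hτ.torsionMap W n P) = -hτ.torsionMap W n (η P) - (2 * k₀ + 1) • hτ.torsionMap W n P)
    (x : galH1Torsion (W.baseChange K) n) :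
    ∃ s r : galH1Torsion (W.baseChange K) n, conjAct W σ n s = s ∧ conjAct W σ n r = -r ∧
      x = ((k₀ + 1) • s + resH1Hom (ContinuousMonoidHom.id _) η hη s) + r :=
  exists_fixed_antifixed_decomp (resH1Hom (ContinuousMonoidHom.id _) η hη) (conjAct W σ n) k₀
    (conjAct_invol W n hσ) (conjAct_anti W n η hη hτ (2 * k₀ + 1) hanti) x

end Curve

/-! ## §3 Finite stable subgroups at level `2^M`: `#S = (#S^{σ})²` -/

section Stable

variable {k : Type v} {K : Type u} [Field k] [Field K] [Algebra k K]
variable (W : WeierstrassCurve k) {σ : K ≃ₐ[k] K} {τ : AlgebraicClosure K ≃+* AlgebraicClosure K}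

/-- **`#S = (#S^{σ})²` for a `σ_*`- and `η_*`-stable subgroup `S ≤ H¹(K, E[2^M])`** (`η² + mη = c` with
`m` odd — then `m² + 4c` is odd, which is all the count needs; e.g. `S = Sel_{2^M}(E/K)`, which both maps preserve when `σ` permutes the places and `η`
comes from an endomorphism of `E` over `K`): `InertOrderSplitting.natCard_eq_sq` on `S`, which is
killed by `2^M` (`zsmul_discreteH1_torsion`). [cite: Lang1987, Ch. 10 §4 Remark] -/
theorem natCard_stable_eq_sq (hσ : σ * σ = 1) (hτ : IsLiftOfAut σ τ) (M : ℕ) (k₀ c : ℤ)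
    (η : geomTorsion (W.baseChange K) ((2 : ℤ) ^ M) →+ geomTorsion (W.baseChange K) ((2 : ℤ) ^ M))
    (hη : ∀ (x : Field.absoluteGaloisGroup K) (P : geomTorsion (W.baseChange K) ((2 : ℤ) ^ M)),
      η (ContinuousMonoidHom.id (Field.absoluteGaloisGroup K) x • P) = x • η P)
    (hrel : ∀ P : geomTorsion (W.baseChange K) ((2 : ℤ) ^ M), η (η P) + (2 * k₀ + 1) • η P = c • P)
    (hanti : ∀ P : geomTorsion (W.baseChange K) ((2 : ℤ) ^ M),
      η (hτ.torsionMap W _ P) = -hτ.torsionMap W _ (η P) - (2 * k₀ + 1) • hτ.torsionMap W _ P)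
    (S : AddSubgroup (galH1Torsion (W.baseChange K) ((2 : ℤ) ^ M)))
    (hSσ : ∀ x ∈ S, conjAct W σ _ x ∈ S)
    (hSη : ∀ x ∈ S, resH1Hom (ContinuousMonoidHom.id _) η hη x ∈ S) :
    Nat.card S = Nat.card {x : S // conjAct W σ _ (x : galH1Torsion (W.baseChange K) ((2 : ℤ) ^ M)) = x} ^ 2 := by
  -- restrict `η_*` and `σ_*` to `S`
  set ηS : S →+ S := ((resH1Hom (ContinuousMonoidHom.id _) η hη).comp S.subtype).codRestrict S
    (fun x ↦ hSη x x.2) with hηS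
  set τS : S →+ S := ((conjAct W σ ((2 : ℤ) ^ M)).comp S.subtype).codRestrict S
    (fun x ↦ hSσ x x.2) with hτS
  have h := natCard_eq_sq ηS τS k₀ c
    (fun v ↦ Subtype.ext (by
      simp only [hηS, AddMonoidHom.codRestrict_apply, AddMonoidHom.coe_comp, AddSubgroup.coe_subtype,
        Function.comp_apply, AddSubgroup.coe_add, AddSubgroupClass.coe_zsmul]
      exact eta_rel_H1 W _ η hη (2 * k₀ + 1) c hrel (v : galH1Torsion (W.baseChange K) ((2 : ℤ) ^ M))))
    (fun v ↦ Subtype.ext (by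
      simp only [hτS, AddMonoidHom.codRestrict_apply, AddMonoidHom.coe_comp, AddSubgroup.coe_subtype,
        Function.comp_apply]
      exact conjAct_invol W _ hσ (v : galH1Torsion (W.baseChange K) ((2 : ℤ) ^ M))))
    (fun v ↦ Subtype.ext (by
      simp only [hηS, hτS, AddMonoidHom.codRestrict_apply, AddMonoidHom.coe_comp, AddSubgroup.coe_subtype,
        Function.comp_apply, AddSubgroup.coe_sub, AddSubgroup.coe_neg, AddSubgroupClass.coe_zsmul]
      exact conjAct_anti W _ η hη hτ (2 * k₀ + 1) hanti (v : galH1Torsion (W.baseChange K) ((2 : ℤ) ^ M))))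
    (M := M) (fun v ↦ Subtype.ext (by
      rw [AddSubgroupClass.coe_zsmul, AddSubgroup.coe_zero]
      exact zsmul_discreteH1_torsion ((2 : ℤ) ^ M) (v : galH1Torsion (W.baseChange K) ((2 : ℤ) ^ M))))
  rw [h]
  congr 1
  refine Nat.card_congr (Equiv.subtypeEquivRight fun x ↦ ?_)
  rw [hτS]
  exact ⟨fun e ↦ congrArg Subtype.val e, fun e ↦ Subtype.ext e⟩

end Stable

end Summit.BirchSwinnertonDyer.BirchSwinnertonDyer.Theorems.InertOrderSplittingH1
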